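import Summits.CriticalPhenomena.CardyFormulaZ2.Theorems.CardyComplexConeParafermionToSLESixFamiliesFlipRLPair
import Summits.CriticalPhenomena.CardyFormulaZ2.Theorems.CardyComplexConeParafermionToSLESixFamiliesCondObsBound
import Summits.CriticalPhenomena.CardyFormulaZ2.Theorems.CardyComplexConeCoherentMoreraKirchhoffFlip
import Literature.Probability.LatticeModels.MedialInterfaceMeasurability
import HarnessLib

/-!
# The flip-involution return law (`stub_returnLaw`)
(line `flip-involution-return-law` of crux `CardyComplexCone.ParafermionToSLESixFamilies`, stmt-CriticalPhenomena-11389;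
closing file of the registered stub `stub_returnLaw : ReturnLaw`)

**Theorem (RL).** For the discretisation `E` of a Jordan Dobrushin domain `D` (`E.Ω = D.carrier`),
`ℤ²`-admissible, and every interior free lattice edge `z` (an edge of `Ω_δ` with both endpoints off both
discrete arcs), the spin-`1/3` vertex observable `F = obs E z`, the in-minus-out mode `S_inout = inOut E z`,
the first-visit amplitude `S₁ = E[Φ₁]` and the phase-weighted returns `Y± = E[Φ₁ ; two visits, first turn ±1]`
of the medial exploration path of critical bond percolation satisfy the three EXACT identities

  `F = cos(π/12)·S₁ + e^{iπ/4}·Y₊ + e^{−iπ/4}·Y₋`,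
  `S_inout = (1 − √3/2)·S₁ + g(1)·Y₊ + g(−1)·Y₋`  (`g(τ) = e^{iτπ/3} − e^{iτπ/6}`),
  `Y₊ + Y₋ = S₁/2`.

Proof. The edge flip `ω ↦ ω △ {z}` preserves `P_{1/2}` (`integralToggleHalf` /
`bondPercolation_half_map_symmDiff`), so `∫ X = ½ ∫ (X + X ∘ flip)` for each of the five integrands
(passage sum, first phase, the two return indicators, in-minus-out sum — all bounded measurable functions of
`medialExploration E ω`); and PAIRWISE the three identities hold in sum form (`returnLaw_pair`, files 1–5:
once/twice structure of the pair of exploration paths, the return arriving antiparallel with winding `−τ₁π`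
because the spliced loop of the Jordan face domain turns by `4σ` — `spliceLoop_turning_eq`,
`holeFree_innerFaces` — and leaving by the forced turn `τ₂ = τ₁`; then the algebra of the twelve phases).

References: H. Duminil-Copin, S. Smirnov, *Conformal invariance of lattice models*, arXiv:1109.1549, §8
(proof of Prop. 8.6: the edge flip at `q = 1`); S. Smirnov, Ann. of Math. 172 (2010), proof of Lemma 4.5.
-/

noncomputable section

namespace Summit.CriticalPhenomena.CardyFormulaZ2.Cruxes.ParafermionToSLESixFamilies.FlipInvolutionReturnLaw

open MeasureTheory Filter Set Metric
open scoped BigOperators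
open Literature.Probability Literature.Probability.LatticeModels Literature.Probability.Percolation
open Literature.Probability.RandomPlanarGeometry (DobrushinDomain)
open Summit.CriticalPhenomena.CardyFormulaZ2.Cruxes.ParafermionToSLESixFamilies.CaratheodoryNetSlitUniformity
  (obs Pc norm_passageSum_medialExploration_le_two card_passages_medialExploration_le_two)
open Summit.CriticalPhenomena.CardyFormulaZ2.Cruxes.CoherentMorera.FinitaryGreenPairing (integralToggleHalf)

/-! ## Bounded measurable functions of the exploration path are integrable -/

/-- A function of the exploration path with a uniform norm bound is integrable under `P_{1/2}`. -/
theorem integrable_of_medialExploration_bound (E : DiscreteDobrushin) {F : BondConfig (Site 2) → ℂ}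
    (hF : ∀ ω ω', medialExploration E ω = medialExploration E ω' → F ω = F ω') (C : ℝ) (hC : ∀ ω, ‖F ω‖ ≤ C) :
    Integrable F Pc :=
  Integrable.of_bound (measurable_of_medialExploration E hF).aestronglyMeasurable C (Eventually.of_forall hC)

/-- `‖firstPhase γ δ z‖ ≤ 1`. -/
theorem norm_firstPhase_le (γ : List MedialVertex) (δ : ℝ) (z : MedialVertex) : ‖firstPhase γ δ z‖ ≤ 1 := by
  rw [firstPhase]
  split_ifs
  · exact (norm_phase _).le
  · simp

/-- The in-minus-out sum of the exploration path has norm `≤ 4` (at most two visits, two unit phases each). -/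
theorem norm_inOutSum_medialExploration_le (E : DiscreteDobrushin) (ω : BondConfig (Site 2)) (δ : ℝ) (z : MedialVertex) :
    ‖inOutSum (medialExploration E ω) δ z‖ ≤ 4 := by
  rw [inOutSum]
  refine (norm_sum_le _ _).trans ?_
  have h2 := card_passages_medialExploration_le_two E ω z
  have hterm : ∀ k ∈ (Finset.range (medialExploration E ω).length).filter (fun k => (medialExploration E ω)[k]? = some z),
      ‖phase (arrW (medialExploration E ω) δ k) - phase (arrW (medialExploration E ω) δ (k + 1))‖ ≤ 2 := by
    intro k _
    refine (norm_sub_le _ _).trans ?_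
    rw [norm_phase, norm_phase]; norm_num
  refine (Finset.sum_le_sum hterm).trans ?_
  rw [Finset.sum_const, nsmul_eq_mul]
  have : (((Finset.range (medialExploration E ω).length).filter (fun k => (medialExploration E ω)[k]? = some z)).card : ℝ) ≤ 2 := by
    exact_mod_cast h2
  linarith

/-! ## The stub -/

/-- **The flip-involution return law** (registered stub `stub_returnLaw` of stmt-CriticalPhenomena-11389, line
`flip-involution-return-law`; exact, finite volume): for Jordan admissible data and every interior free
lattice edge `z`, (i) `obs E z = cos(π/12)·S1 + e^{iπ/4}·Yplus + e^{−iπ/4}·Yminus`, (ii) `inOut E z =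
(1 − √3/2)·S1 + g(1)·Yplus + g(−1)·Yminus`, (iii) `Yplus + Yminus = S1/2`. -/
theorem stub_returnLaw : ReturnLaw := by
  intro D E hΩ hE z
  induction z using Sym2.inductionOn with
  | hf x y => ?_
  intro hz hzi
  classical
  -- a corner `p` with `cTgt p = s(x, y)`
  have hadj : (zdGraph 2).Adj x y := meshGraph_le_zdGraph _ _ (discreteDomainGraph_adj_iff.1 ((SimpleGraph.mem_edgeSet _).1 hz)).1
  obtain ⟨k, rfl⟩ := exists_eq_add_cornerUnit hadj
  have hp : cTgt ((x, k + 3) : Site 2 × Fin 4) = s(x, x + cornerUnit k) := by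
    show s(x, x + cornerUnit (k + 3 + 1)) = _
    rw [fin4_add_three_add_one]
  rw [← hp] at hz hzi ⊢
  set p : Site 2 × Fin 4 := (x, k + 3) with hpdef
  have he : cTgt p ∈ (zdGraph 2).edgeSet := cTgt_mem_edgeSet p
  -- the five integrands
  set PS : BondConfig (Site 2) → ℂ := fun ω => MedialPath.passageSum (medialExploration E ω) E.δ (1 / 3) (cTgt p) with hPS
  set FP : BondConfig (Site 2) → ℂ := fun ω => firstPhase (medialExploration E ω) E.δ (cTgt p) with hFP
  set TP : BondConfig (Site 2) → ℂ := fun ω => (if 2 ≤ (medialExploration E ω).count (cTgt p) ∧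
      FlipInvolutionReturnLaw.turnSign (medialExploration E ω) E.δ ((medialExploration E ω).idxOf (cTgt p)) = 1
      then firstPhase (medialExploration E ω) E.δ (cTgt p) else 0) with hTP
  set TM : BondConfig (Site 2) → ℂ := fun ω => (if 2 ≤ (medialExploration E ω).count (cTgt p) ∧
      FlipInvolutionReturnLaw.turnSign (medialExploration E ω) E.δ ((medialExploration E ω).idxOf (cTgt p)) = -1
      then firstPhase (medialExploration E ω) E.δ (cTgt p) else 0) with hTM
  set IO : BondConfig (Site 2) → ℂ := fun ω => inOutSum (medialExploration E ω) E.δ (cTgt p) with hIO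
  -- integrability
  have iPS : Integrable PS Pc := integrable_of_medialExploration_bound E (fun ω ω' h => by simp only [hPS, h]) 2
    (fun ω => norm_passageSum_medialExploration_le_two E ω _ _ _)
  have iFP : Integrable FP Pc := integrable_of_medialExploration_bound E (fun ω ω' h => by simp only [hFP, h]) 1
    (fun ω => norm_firstPhase_le _ _ _)
  have iTP : Integrable TP Pc := integrable_of_medialExploration_bound E (fun ω ω' h => by simp only [hTP, h]) 1
    (fun ω => by
      simp only [hTP]
      split_ifs
      · exact norm_firstPhase_le _ _ _
      · simp)
  have iTM : Integrable TM Pc := integrable_of_medialExploration_bound E (fun ω ω' h => by simp only [hTM, h]) 1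
    (fun ω => by
      simp only [hTM]
      split_ifs
      · exact norm_firstPhase_le _ _ _
      · simp)
  have iIO : Integrable IO Pc := integrable_of_medialExploration_bound E (fun ω ω' h => by simp only [hIO, h]) 4
    (fun ω => norm_inOutSum_medialExploration_le E ω _ _)
  -- flip invariance of the five expectations
  have flip : ∀ {G : BondConfig (Site 2) → ℂ}, Integrable G Pc → ∫ ω, G (symmDiff ω {cTgt p}) ∂Pc = ∫ ω, G ω ∂Pc :=
    fun hG => integralToggleHalf (Site 2) (zdGraph 2) (cTgt p) _ he hG.aestronglyMeasurable
  have iflip : ∀ {G : BondConfig (Site 2) → ℂ}, Integrable G Pc → Integrable (fun ω => G (symmDiff ω {cTgt p})) Pc := by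
    intro G hG
    have hmap : Pc.map (fun ω : BondConfig (Site 2) => symmDiff ω {cTgt p}) = Pc :=
      Summit.CriticalPhenomena.CardyFormulaZ2.Cruxes.EdgePrecompact.QkzStripBoundaryArm.bondPercolation_half_map_symmDiff he
    have h1 : Integrable G (Pc.map (fun ω : BondConfig (Site 2) => symmDiff ω {cTgt p})) := by rwa [hmap]
    exact h1.comp_measurable
      (Summit.CriticalPhenomena.CardyFormulaZ2.Cruxes.EdgePrecompact.QkzStripBoundaryArm.measurable_symmDiff_singleton _)
  have two : ∀ {G : BondConfig (Site 2) → ℂ}, Integrable G Pc →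
      ∫ ω, (G ω + G (symmDiff ω {cTgt p})) ∂Pc = 2 * ∫ ω, G ω ∂Pc := by
    intro G hG
    rw [integral_add hG (iflip hG), flip hG]; ring
  -- the pairwise identities
  have pair := returnLaw_pair D E hΩ hE p hz hzi
  dsimp only at pair
  have E1 : ∫ ω, (PS ω + PS (symmDiff ω {cTgt p})) ∂Pc =
      ∫ ω, ((Real.cos (Real.pi / 12) : ℂ) * (FP ω + FP (symmDiff ω {cTgt p})) +
        Complex.exp (Complex.I * (Real.pi : ℂ) / 4) * (TP ω + TP (symmDiff ω {cTgt p})) +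
        Complex.exp (-(Complex.I * (Real.pi : ℂ) / 4)) * (TM ω + TM (symmDiff ω {cTgt p}))) ∂Pc :=
    integral_congr_ae (Eventually.of_forall fun ω => (pair ω).1)
  have E2 : ∫ ω, (IO ω + IO (symmDiff ω {cTgt p})) ∂Pc =
      ∫ ω, ((1 - (Real.sqrt 3 : ℂ) / 2) * (FP ω + FP (symmDiff ω {cTgt p})) +
        gTilt 1 * (TP ω + TP (symmDiff ω {cTgt p})) + gTilt (-1) * (TM ω + TM (symmDiff ω {cTgt p}))) ∂Pc :=
    integral_congr_ae (Eventually.of_forall fun ω => (pair ω).2.1)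
  have E3 : ∫ ω, ((TP ω + TM ω) + (TP (symmDiff ω {cTgt p}) + TM (symmDiff ω {cTgt p}))) ∂Pc =
      ∫ ω, ((FP ω + FP (symmDiff ω {cTgt p})) / 2) ∂Pc :=
    integral_congr_ae (Eventually.of_forall fun ω => (pair ω).2.2)
  -- expand the integrals
  have iFP2 : Integrable (fun ω => FP ω + FP (symmDiff ω {cTgt p})) Pc := iFP.add (iflip iFP)
  have iTP2 : Integrable (fun ω => TP ω + TP (symmDiff ω {cTgt p})) Pc := iTP.add (iflip iTP)
  have iTM2 : Integrable (fun ω => TM ω + TM (symmDiff ω {cTgt p})) Pc := iTM.add (iflip iTM)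
  have cFP : ∀ c : ℂ, Integrable (fun ω => c * (FP ω + FP (symmDiff ω {cTgt p}))) Pc := fun c => iFP2.const_mul c
  have cTP : ∀ c : ℂ, Integrable (fun ω => c * (TP ω + TP (symmDiff ω {cTgt p}))) Pc := fun c => iTP2.const_mul c
  have cTM : ∀ c : ℂ, Integrable (fun ω => c * (TM ω + TM (symmDiff ω {cTgt p}))) Pc := fun c => iTM2.const_mul c
  have iA1 : Integrable (fun ω => (Real.cos (Real.pi / 12) : ℂ) * (FP ω + FP (symmDiff ω {cTgt p})) +
      Complex.exp (Complex.I * (Real.pi : ℂ) / 4) * (TP ω + TP (symmDiff ω {cTgt p}))) Pc := (cFP _).add (cTP _)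
  have iA2 : Integrable (fun ω => (1 - (Real.sqrt 3 : ℂ) / 2) * (FP ω + FP (symmDiff ω {cTgt p})) +
      gTilt 1 * (TP ω + TP (symmDiff ω {cTgt p}))) Pc := (cFP _).add (cTP _)
  rw [two iPS, integral_add iA1 (cTM _), integral_add (cFP _) (cTP _), integral_const_mul, integral_const_mul,
    integral_const_mul, two iFP, two iTP, two iTM] at E1
  rw [two iIO, integral_add iA2 (cTM _), integral_add (cFP _) (cTP _), integral_const_mul, integral_const_mul,
    integral_const_mul, two iFP, two iTP, two iTM] at E2
  have E3' : ∫ ω, ((TP ω + TM ω) + (TP (symmDiff ω {cTgt p}) + TM (symmDiff ω {cTgt p}))) ∂Pc =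
      2 * ∫ ω, TP ω ∂Pc + 2 * ∫ ω, TM ω ∂Pc := by
    have : (fun ω => (TP ω + TM ω) + (TP (symmDiff ω {cTgt p}) + TM (symmDiff ω {cTgt p}))) =
        fun ω => (TP ω + TP (symmDiff ω {cTgt p})) + (TM ω + TM (symmDiff ω {cTgt p})) := by
      funext ω; ring
    rw [this, integral_add iTP2 iTM2, two iTP, two iTM]
  rw [E3', integral_div, two iFP] at E3
  -- the five expectations are the line's quantities
  have hobs : obs E (cTgt p) = ∫ ω, PS ω ∂Pc := rfl
  have hS1 : S1 E (cTgt p) = ∫ ω, FP ω ∂Pc := rfl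
  have hYp : Yplus E (cTgt p) = ∫ ω, TP ω ∂Pc := rfl
  have hYm : Yminus E (cTgt p) = ∫ ω, TM ω ∂Pc := rfl
  have hIOe : inOut E (cTgt p) = ∫ ω, IO ω ∂Pc := rfl
  rw [hobs, hS1, hYp, hYm, hIOe]
  refine ⟨?_, ?_, ?_⟩
  · linear_combination (1 / 2 : ℂ) * E1
  · linear_combination (1 / 2 : ℂ) * E2
  · linear_combination (1 / 2 : ℂ) * E3

end Summit.CriticalPhenomena.CardyFormulaZ2.Cruxes.ParafermionToSLESixFamilies.FlipInvolutionReturnLaw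

end
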